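import Summits.AtomisticToContinuum.Crystallization.Theorems.ChartedZeroExcessLayeredLatticeLiouvilleZZZYRCE

/-!
# Charted zero-excess layered-lattice Liouville — ZZZYRCG: the ATLAS GLUE (K-file theorem shapes for line (D) + E″, PROVED)

Cell `decomp-a2c`, lens 2, generation 99.  After the TAIL-DEBIT pilot PASS (census l.9472) the remaining content of the chain
(RI♯) ∧ (K♯-W) ∧ (TL♯-D) ∧ (PF♯) ∧ (PF♯-D) ∧ (JF♯-DW) ∧ (CZ♯) ⇒ (U♯) (door `uniformEquilStabilityAt_of_cells_debit`, ZZZYRCE) is delivered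
BOX BY BOX by K-files over a finite ATLAS of the admissible class.  This file fixes the shapes once, over an abstract index type `ι` and abstract
membership predicates `InBox i L w'`:

* `AtlasCoversP s Λ c₀ ℓ₀ InBox` — ★ JSBOX-SOUND / CELLBOX-SOUND as ONE Prop: every admissible word lies in some box (memo NODE-g99 §2(h):
  CELL-ID ID-3/4 + NASH-PIN-h and NASH-PIN-r + the typed-clean budget prove it for the concrete atlas); `exists_selector_of_covers` turns it into a box
  selector `sel` with `InBox (sel L w') L w'` on admissible words (choice; the W-Props of ZZZYRCE take arbitrary word-indexed data, so a
  non-computable selector is harmless).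
* PER-BOX OBLIGATIONS = the K-file theorem shapes: `BoxCellCertificateP … (InBox i) (c i)` (a CELLBOX-K file: NODE E's cell certificate at the
  box's constant `c_β`), `BoxTailDebitP … (InBox i) (ΘR i) (ΘN i) γT` (the tail bound with the box's tables — discharged generically from table
  domination by TL-1/TL-IS (ZZZYRCF) + Fubini + the HasSum split), `BoxClusterCertificateDebitP … (InBox i) (cK i) (ΘR i) (ΘN i) κ₁` (a JS-D file:
  the debit cluster certificate with closure `2κ₁ ≤ μ·cK_i − ν`, `cK_i = 1/10` or `1/c_β(i)`).
* ATLAS GLUE (PROVED): `cellCertificateW_of_atlas`, `tailDebitP_of_atlas`, `clusterCertificateDebitW_of_atlas` (per-box families ⇒ the W-Props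
  of ZZZYRCE with the selected box's data) and the door `uniformEquilStabilityAt_of_atlas`:
  (RI♯) ∧ (CS♯) ∧ (NC♯) ∧ AtlasCovers ∧ (∀ i, BoxCell (c i)) ∧ (∀ i, BoxTail) ∧ (PF♯) ∧ (PF♯-D) ∧ (∀ i, BoxCluster (cK i)) ∧ (CZ♯) ⇒ (U♯),
  for `0 ≤ cK i`, `cK i · c i ≤ 1`, `0 ≤ κ₁`, `κ₀ ≤ κ₁·cZ − γT`.

Def + theorem file (4 defs, 6 theorems); imports ZZZYRCE; no instance / notation / option; 0 sorry. [g99]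
-/

open scoped BigOperators InnerProductSpace RealInnerProductSpace

namespace Summit.AtomisticToContinuum.Crystallization.Theorems.ChartedZeroExcessLayeredLatticeLiouville

open Summit.AtomisticToContinuum.Crystallization.Theorems.ChartedPlanarOrderRigidityDoor (E3)

variable {ι : Type*}

/-! ### Coverage and the selector -/

/-- ★ **«AtlasCoversP s Λ c₀ ℓ₀ InBox»** — the atlas covers the admissible class: every admissible word `(L, w')` (at any scale `a`) satisfies
`InBox i L w'` for some box index `i`.  For the concrete JS-D / CELLBOX-K atlas this is JSBOX-SOUND ∧ CELLBOX-SOUND (memo NODE-g99 §2(h), NODE-g98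
§10/§14).  support · GENERIC. [g99] -/
def AtlasCoversP (s Λ c₀ ℓ₀ : ℝ) (InBox : ι → (E3 ≃L[ℝ] E3) → (ℤ → E3) → Prop) : Prop :=
  ∀ a : ℝ, 0 < a → ∀ (L : E3 ≃L[ℝ] E3) (w' : ℤ → E3), IsAdmissibleWord a s Λ c₀ ℓ₀ L w' → ∃ i, InBox i L w'

/-- coverage ⇒ a box SELECTOR on admissible words (axiom of choice; `i₀` is the value off the class). [g99] -/
theorem exists_selector_of_covers {s Λ c₀ ℓ₀ : ℝ} {InBox : ι → (E3 ≃L[ℝ] E3) → (ℤ → E3) → Prop} (i₀ : ι)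
    (hcov : AtlasCoversP s Λ c₀ ℓ₀ InBox) :
    ∃ sel : (E3 ≃L[ℝ] E3) → (ℤ → E3) → ι,
      ∀ a : ℝ, 0 < a → ∀ (L : E3 ≃L[ℝ] E3) (w' : ℤ → E3), IsAdmissibleWord a s Λ c₀ ℓ₀ L w' → InBox (sel L w') L w' := by
  classical
  refine ⟨fun L w' => if h : ∃ i, InBox i L w' then Classical.choose h else i₀, ?_⟩
  intro a ha L w' hA
  have h : ∃ i, InBox i L w' := hcov a ha L w' hA
  simp only [dif_pos h]
  exact Classical.choose_spec h

/-! ### Per-box obligations (the K-file theorem shapes) -/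

/-- **CELLBOX-K shape «BoxCellCertificateP s Λ c₀ ℓ₀ r₁ B c»**: on the admissible words of box `B`, ONE multiplier `μ` per word makes every
tetrahedral / octahedral cell certificate at constant `c` non-negative (NODE E's (CC♯) restricted to the box; `c = c_β`). [g99] -/
def BoxCellCertificateP (s Λ c₀ ℓ₀ r₁ : ℝ) (B : (E3 ≃L[ℝ] E3) → (ℤ → E3) → Prop) (c : ℝ) : Prop :=
  ∀ a : ℝ, 0 < a → ∀ (L : E3 ≃L[ℝ] E3) (w' : ℤ → E3), IsAdmissibleWord a s Λ c₀ ℓ₀ L w' → B L w' →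
    ∃ μ : ℝ, ∀ φ : Cell 2 → ℤ → E3,
      (∀ t ∈ tetCells r₁ (gen₁ L) (gen₂ L) w', 0 ≤ tetCert c μ (gen₁ L) (gen₂ L) w' φ t) ∧
        ∀ o ∈ octCells r₁ (gen₁ L) (gen₂ L) w', 0 ≤ octCert c μ (gen₁ L) (gen₂ L) w' φ o

/-- **TAIL shape «BoxTailDebitP s Λ c₀ ℓ₀ ϱ B ΘR ΘN γT»**: (TL♯-D) restricted to the admissible words of box `B`, with the box's tables. [g99] -/
def BoxTailDebitP (s Λ c₀ ℓ₀ ϱ : ℝ) (B : (E3 ≃L[ℝ] E3) → (ℤ → E3) → Prop)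
    (ΘR ΘN : (E3 ≃L[ℝ] E3) → (ℤ → E3) → (Cell 2 × ℤ) × (Cell 2 × ℤ) → ℝ) (γT : ℝ) : Prop :=
  ∀ a : ℝ, 0 < a → ∀ (L : E3 ≃L[ℝ] E3) (w' : ℤ → E3), IsAdmissibleWord a s Λ c₀ ℓ₀ L w' → B L w' →
    ∀ φ : Cell 2 → ℤ → E3, HasFiniteSupport φ → ∀ E : ℝ,
      HasSum (fun x : (Cell 2 × ℤ) × (Cell 2 × ℤ) =>
        ⟪φ x.2.1 x.2.2 - φ x.1.1 x.1.2,
          layeredKernel (gen₁ L) (gen₂ L) w' (x.2.1 - x.1.1) x.1.2 x.2.2 (φ x.2.1 x.2.2 - φ x.1.1 x.1.2)⟫) E →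
      rangeHessSum ϱ (gen₁ L) (gen₂ L) w' φ - debitForm ϱ (ΘR L w') (ΘN L w') (gen₁ L) (gen₂ L) w' φ - 2 * γT * nnFormZ φ ≤ E

/-- **JS-D shape «BoxClusterCertificateDebitP s Λ c₀ ℓ₀ r₁ ϱ R B cK ΘR ΘN κ₁»**: (JF♯-D) restricted to the admissible words of box `B` with the
box's Korn constant `cK` (`1/10`, or `1/c_β` for E″) and tables. [g99] -/
def BoxClusterCertificateDebitP (s Λ c₀ ℓ₀ r₁ ϱ R : ℝ) (B : (E3 ≃L[ℝ] E3) → (ℤ → E3) → Prop) (cK : ℝ)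
    (ΘR ΘN : (E3 ≃L[ℝ] E3) → (ℤ → E3) → (Cell 2 × ℤ) × (Cell 2 × ℤ) → ℝ) (κ₁ : ℝ) : Prop :=
  ∀ a : ℝ, 0 < a → ∀ (L : E3 ≃L[ℝ] E3) (w' : ℤ → E3), IsAdmissibleWord a s Λ c₀ ℓ₀ L w' → B L w' →
    ∃ (μ ν : ℝ) (d : ℤ → Cell 2) (Cpar : ℤ → Fin 3 → Fin 3 → (E3 →L[ℝ] E3)) (Cperp : Fin 3 → Fin 3 → (E3 →L[ℝ] E3)),
      0 ≤ μ ∧ IsShortStep r₁ (gen₁ L) (gen₂ L) w' d ∧ 2 * κ₁ ≤ μ * cK - ν ∧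
      ∀ (c : Cell 2 × ℤ) (φ : Cell 2 → ℤ → E3), HasFiniteSupport φ →
        clusterDebit ϱ R (ΘR L w') (ΘN L w') (gen₁ L) (gen₂ L) w' c φ ≤ clusterFormFull r₁ ϱ R μ ν d Cpar Cperp (gen₁ L) (gen₂ L) w' c φ

/-! ### Atlas glue -/

/-- per-box cell certificates + a selector ⇒ (CC♯-W) with `cf L w' := c (sel L w')`. [g99] -/
theorem cellCertificateW_of_atlas {s Λ c₀ ℓ₀ r₁ : ℝ} {InBox : ι → (E3 ≃L[ℝ] E3) → (ℤ → E3) → Prop} {c : ι → ℝ}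
    {sel : (E3 ≃L[ℝ] E3) → (ℤ → E3) → ι}
    (hsel : ∀ a : ℝ, 0 < a → ∀ (L : E3 ≃L[ℝ] E3) (w' : ℤ → E3), IsAdmissibleWord a s Λ c₀ ℓ₀ L w' → InBox (sel L w') L w')
    (hbox : ∀ i, BoxCellCertificateP s Λ c₀ ℓ₀ r₁ (InBox i) (c i)) :
    CellCertificateW s Λ c₀ ℓ₀ r₁ (fun L w' => c (sel L w')) :=
  fun a ha L w' hA => hbox (sel L w') a ha L w' hA (hsel a ha L w' hA)

/-- per-box tail bounds + a selector ⇒ (TL♯-D) with the selected box's tables. [g99] -/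
theorem tailDebitP_of_atlas {s Λ c₀ ℓ₀ ϱ γT : ℝ} {InBox : ι → (E3 ≃L[ℝ] E3) → (ℤ → E3) → Prop}
    {ΘR ΘN : ι → (E3 ≃L[ℝ] E3) → (ℤ → E3) → (Cell 2 × ℤ) × (Cell 2 × ℤ) → ℝ} {sel : (E3 ≃L[ℝ] E3) → (ℤ → E3) → ι}
    (hsel : ∀ a : ℝ, 0 < a → ∀ (L : E3 ≃L[ℝ] E3) (w' : ℤ → E3), IsAdmissibleWord a s Λ c₀ ℓ₀ L w' → InBox (sel L w') L w')
    (hbox : ∀ i, BoxTailDebitP s Λ c₀ ℓ₀ ϱ (InBox i) (ΘR i) (ΘN i) γT) :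
    TailDebitP s Λ c₀ ℓ₀ ϱ (fun L w' => ΘR (sel L w') L w') (fun L w' => ΘN (sel L w') L w') γT :=
  fun a ha L w' hA φ hφ E hE => hbox (sel L w') a ha L w' hA (hsel a ha L w' hA) φ hφ E hE

/-- per-box debit cluster certificates + a selector ⇒ (JF♯-DW) with `cKf L w' := cK (sel L w')` and the selected tables. [g99] -/
theorem clusterCertificateDebitW_of_atlas {s Λ c₀ ℓ₀ r₁ ϱ R κ₁ : ℝ} {InBox : ι → (E3 ≃L[ℝ] E3) → (ℤ → E3) → Prop} {cK : ι → ℝ}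
    {ΘR ΘN : ι → (E3 ≃L[ℝ] E3) → (ℤ → E3) → (Cell 2 × ℤ) × (Cell 2 × ℤ) → ℝ} {sel : (E3 ≃L[ℝ] E3) → (ℤ → E3) → ι}
    (hsel : ∀ a : ℝ, 0 < a → ∀ (L : E3 ≃L[ℝ] E3) (w' : ℤ → E3), IsAdmissibleWord a s Λ c₀ ℓ₀ L w' → InBox (sel L w') L w')
    (hbox : ∀ i, BoxClusterCertificateDebitP s Λ c₀ ℓ₀ r₁ ϱ R (InBox i) (cK i) (ΘR i) (ΘN i) κ₁) :
    ClusterCertificateDebitW s Λ c₀ ℓ₀ r₁ ϱ R (fun L w' => cK (sel L w')) (fun L w' => ΘR (sel L w') L w')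
      (fun L w' => ΘN (sel L w') L w') κ₁ :=
  fun a ha L w' hA => hbox (sel L w') a ha L w' hA (hsel a ha L w' hA)

/-- ★★ **THE ATLAS DOOR (PROVED): (RI♯) ∧ (CS♯) ∧ (NC♯) ∧ AtlasCovers ∧ (∀ i, BoxCell (c i)) ∧ (∀ i, BoxTail) ∧ (PF♯) ∧ (PF♯-D) ∧
(∀ i, BoxCluster (cK i)) ∧ (CZ♯) ⇒ (U♯) `UniformEquilStabilityAt s Λ κ₀ c₀`**, for box constants `0 ≤ cK i`, `cK i · c i ≤ 1` (E″: `cK i = 1/c i`,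
`0 < c i`; uniform: `cK i = 1/10 ≤ 1/c i`), `0 ≤ κ₁`, `κ₀ ≤ κ₁·cZ − γT`.  This is the statement the finite K-file atlas discharges box by box; the
generic items left are (RI♯), (CS♯), (NC♯), (PF♯), (PF♯-D), (CZ♯), the generic tail theorem behind BoxTail, and AtlasCovers (JSBOX/CELLBOX-SOUND). [g99] -/
theorem uniformEquilStabilityAt_of_atlas {s Λ c₀ ℓ₀ r₁ ϱ R cZ κ₁ κ₀ γT : ℝ} {InBox : ι → (E3 ≃L[ℝ] E3) → (ℤ → E3) → Prop}
    {c cK : ι → ℝ} {ΘR ΘN : ι → (E3 ≃L[ℝ] E3) → (ℤ → E3) → (Cell 2 × ℤ) × (Cell 2 × ℤ) → ℝ} (i₀ : ι)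
    (h0 : 0 ≤ κ₁) (hκ : κ₀ ≤ κ₁ * cZ - γT) (hRI : UniformReindexP s Λ c₀ ℓ₀)
    (hcK0 : ∀ i, 0 ≤ cK i) (hcK : ∀ i, cK i * c i ≤ 1)
    (hCS : CellSumP s Λ c₀ ℓ₀ r₁) (hNC : CellNullLagrangianP s Λ c₀ ℓ₀ r₁) (hcov : AtlasCoversP s Λ c₀ ℓ₀ InBox)
    (hcell : ∀ i, BoxCellCertificateP s Λ c₀ ℓ₀ r₁ (InBox i) (c i)) (htail : ∀ i, BoxTailDebitP s Λ c₀ ℓ₀ ϱ (InBox i) (ΘR i) (ΘN i) γT)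
    (hPU : PartitionIdentityFullP s Λ c₀ ℓ₀ r₁ ϱ R) (hPD : PartitionIdentityDebitP s Λ c₀ ℓ₀ ϱ R)
    (hclus : ∀ i, BoxClusterCertificateDebitP s Λ c₀ ℓ₀ r₁ ϱ R (InBox i) (cK i) (ΘR i) (ΘN i) κ₁) (hCZ : IndexCurrencyP s Λ c₀ ℓ₀ r₁ cZ) :
    UniformEquilStabilityAt s Λ κ₀ c₀ := by
  obtain ⟨sel, hsel⟩ := exists_selector_of_covers i₀ hcov
  have hCC : CellCertificateW s Λ c₀ ℓ₀ r₁ (fun L w' => c (sel L w')) := cellCertificateW_of_atlas hsel hcell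
  have hK : UniformContactKornW s Λ c₀ ℓ₀ r₁ (fun L w' => cK (sel L w')) :=
    uniformContactKornW_of_cellCertificateW (fun a ha L w' hA => hcK0 _) (fun a ha L w' hA => hcK _) hCS hNC hCC
  exact uniformEquilStabilityAt_of_clusterCertificateDebitW h0 hκ hRI hK (tailDebitP_of_atlas hsel htail) hPU hPD
    (clusterCertificateDebitW_of_atlas hsel hclus) hCZ

end Summit.AtomisticToContinuum.Crystallization.Theorems.ChartedZeroExcessLayeredLatticeLiouville
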